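import Literature.NumberTheory.GaloisRepresentations.SUnitsLayerBridgeTransport
import Literature.NumberTheory.GaloisRepresentations.RestrictedRamificationCycCapLayers
import Literature.NumberTheory.GaloisRepresentations.IdeleSUnitsLayerChaseArith
import Literature.NumberTheory.NumberFields.CongruenceSubgroupTorsionFree
import Mathlib.NumberTheory.NumberField.InfinitePlace.TotallyRealComplex
import HarnessLib

/-!
# LAYER SUPPLY in degree `3`: a `p`-torsion class of `H³(Gal(E/F₀), 𝒪_{E,S}ˣ)` dies on a layer
# `E′ ⊇ E` inside `K_S` (NSW (8.3.11) (iv), over a totally complex base)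

Topic `NumberTheory/GaloisCohomology`; namespace `Literature.NumberTheory.GaloisCohomology`.  THEOREMS
ONLY (no definition, no named fact, no `sorry`, no instance; D-0026).  Brick (A4-iv) of lane «PT3-TC»
of cell `bsd-eis` (crux `GoodLatticeBDPValue`, stmt-BirchSwinnertonDyer-19032; road memo `PT3TC-ROAD.md`),
in the binder shape consumed by the colimit discharge (A2-β2) / (A5): intermediate fields
`F₀ ≤ E ≤ E′` of `K̄/K` with the inclusion algebras `algOfLE`, the inflations `SUnits.Layers.layerInf`
of `SUnitsLayerInflation.lean`.

* **`exists_layerInf_three_eq_zero`** — `K` a totally complex number field, `S` a finite set of finite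
  places containing the places above `p`, `F₀ ≤ E ⊆ K_S` with `E/K` finite Galois: every
  `c ∈ H³(Gal(E/F₀), 𝒪_{E,S}ˣ)` with `p • c = 0` has `layerInf_{E→E′} c = 0` for some finite Galois
  `E′ ⊇ E` inside `K_S`.  ASSEMBLY of the lane's bricks: the two layers `E ≤ E₁ ≤ E₂` of
  `exists_cycCapLayers` (`E₁` cyclotomic with `p^{v_p[E:F₀]}·n_v(E) ∣ n_v(E₁)` on the places above `S`,
  `E₂` capitulating the `S`-idèles of `E₁`; seats `-w4`/`-w5`/`-w6`), the idelic chase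
  `sUnitsIdeleInf_sUnitsIdeleInf_three_eq_zero` (NSW (8.3.11) (iv) at finite layers, seat `-w7`), and
  the transport `map_sUnitsBridge_layerInf_eq` / `map_sUnitsBridge_injective` between the idelic and the
  integral models of `𝒪_{E,S}ˣ` (`SUnitsLayerBridgeTransport.lean`).

HONEST FRAMING: a finite-layer vanishing statement for `S`-unit cohomology over a totally complex base;
no case of Poitou–Tate / `cd_p(G_S) ≤ 2` / BSD is proved in this file (that is the (A5) assembly).

## References
* J. Neukirch, A. Schmidt, K. Wingberg, *Cohomology of Number Fields*, 2nd ed. (2008), VIII §3,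
  (8.3.11) (iv), proof of (8.3.18). [NeukirchSchmidtWingberg2008]
* D. Harari, *Galois Cohomology and Class Field Theory* (2020), §17.4, Cor. 17.14. [Harari2020]
-/

noncomputable section

open NumberField IsDedekindDomain CategoryTheory
open Literature.NumberTheory.GaloisRepresentations
open Literature.NumberTheory.GaloisRepresentations.OpenSubgroupLayer (algOfLE isScalarTower_algOfLE)
open Literature.NumberTheory.GaloisRepresentations.IdeleCohomology
open Literature.NumberTheory.GaloisRepresentations.SUnits
open Literature.NumberTheory.GaloisRepresentations.SUnits.Layers

namespace Literature.NumberTheory.GaloisCohomology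

/-- **LAYER SUPPLY, degree 3 (NSW (8.3.11) (iv)).**  Let `K` be a totally complex number field, `S` a
finite set of finite places of `K` containing the places above the prime `p`, `F₀ ≤ E` intermediate
fields of `K̄/K` with `E/K` finite Galois and `E ⊆ K_S` (`N_S ≤ Gal(K̄/E)`).  Then for every class
`c ∈ H³(Gal(E/F₀), 𝒪_{E,S}ˣ)` killed by `p` there is a finite Galois `E′ ⊇ E` inside `K_S` with
`Inf_{E→E′} c = 0` in `H³(Gal(E′/F₀), 𝒪_{E′,S}ˣ)`.  Proof: `E′ := E₂` for the layers `E ≤ E₁ ≤ E₂`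
of `exists_cycCapLayers` at the exponent `k = v_p([E:F₀])`; the idelic chase
`sUnitsIdeleInf_sUnitsIdeleInf_three_eq_zero` kills the bridge image of `c` two layers up, and the
bridge `𝒪_{E,S}ˣ ≅` (principal `S`-idèles) is an isomorphism compatible with the inflations.
[cite: NeukirchSchmidtWingberg2008, VIII §3 (8.3.11) (iv)] [cite: Harari2020, §17.4, Cor. 17.14] -/
theorem exists_layerInf_three_eq_zero {K : Type} [Field K] [NumberField K] [IsTotallyComplex K]
    (S : Set (HeightOneSpectrum (𝓞 K))) (hfin : S.Finite) (p : ℕ) [Fact p.Prime]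
    (hSp : ∀ v : HeightOneSpectrum (𝓞 K), ((p : ℕ) : 𝓞 K) ∈ v.asIdeal → v ∈ S)
    {F₀ E : IntermediateField K (AlgebraicClosure K)} [FiniteDimensional K E] [IsGalois K E]
    (hF : F₀ ≤ E) (hS : ramificationSubgroup K S ≤ LocalWeilDatum.galFixing K E)
    (c : letI := algOfLE hF; groupCohomology (sUnitsRep K S F₀ E) 3) (hc : p • c = 0) :
    ∃ (E' : IntermediateField K (AlgebraicClosure K)) (_ : FiniteDimensional K E') (_ : IsGalois K E')
      (hEE' : E ≤ E') (_ : ramificationSubgroup K S ≤ LocalWeilDatum.galFixing K E'),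
      SUnits.Layers.layerInf S hF hEE' 3 c = 0 := by
  classical
  have hpp : p.Prime := Fact.out
  letI := algOfLE hF
  haveI : FiniteDimensional K F₀ :=
    FiniteDimensional.of_injective (IntermediateField.inclusion hF).toLinearMap
      (IntermediateField.inclusion hF).injective
  haveI : NumberField F₀ := NumberField.of_module_finite K F₀
  haveI : NumberField E := NumberField.of_module_finite K E
  -- the finite set `S₀` of places of `F₀` above `S`; it contains a place above `p`
  obtain ⟨S₀, hSF⟩ := exists_finset_mem_iff_under_mem (S := S) hfin F₀
  have hSne : S₀.Nonempty := by
    obtain ⟨u, hu⟩ :=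
      Literature.NumberTheory.NumberFields.RingOfIntegers.exists_heightOneSpectrum_natCast_mem F₀ hpp
    refine ⟨u, (hSF u).2 (hSp _ ?_)⟩
    have h1 : algebraMap (𝓞 K) (𝓞 F₀) ((p : ℕ) : 𝓞 K) ∈ u.asIdeal := by rwa [map_natCast]
    exact h1
  -- the two layers `E ≤ E₁ ≤ E₂`
  obtain ⟨E₁, h₁, fin₁, gal₁, E₂, h₂, fin₂, gal₂, hS₁, hS₂, hdeg, hcap⟩ :=
    exists_cycCapLayers S p hSp hF hS S₀ ((Module.finrank F₀ E).factorization p)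
  haveI := fin₁
  haveI := gal₁
  haveI := fin₂
  haveI := gal₂
  refine ⟨E₂, fin₂, gal₂, h₁.trans h₂, hS₂, ?_⟩
  -- instances along the chain `F₀ ≤ E ≤ E₁ ≤ E₂`
  letI := algOfLE h₁
  letI := algOfLE h₂
  letI := algOfLE (hF.trans h₁)
  letI := algOfLE ((hF.trans h₁).trans h₂)
  haveI : NumberField E₁ := NumberField.of_module_finite K E₁
  haveI : NumberField E₂ := NumberField.of_module_finite K E₂
  haveI := isScalarTower_algOfLE (K := K) hF
  haveI := isScalarTower_algOfLE (K := K) (hF.trans h₁)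
  haveI := isScalarTower_algOfLE (K := K) ((hF.trans h₁).trans h₂)
  haveI := isScalarTower_algOfLE₃ hF h₁
  haveI := isScalarTower_algOfLE₃ (hF.trans h₁) h₂
  haveI : IsGalois F₀ E := IsGalois.tower_top_of_isGalois K F₀ E
  haveI : IsGalois F₀ E₁ := IsGalois.tower_top_of_isGalois K F₀ E₁
  haveI : IsGalois F₀ E₂ := IsGalois.tower_top_of_isGalois K F₀ E₂
  haveI : IsTotallyComplex F₀ := NumberField.isTotallyComplex_of_algebra K F₀
  -- `E`, `E₁` are unramified over `F₀` outside `S₀`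
  have hSu : ∀ u : HeightOneSpectrum (𝓞 F₀), u ∉ S₀ → Algebra.IsUnramifiedIn (R := 𝓞 F₀) (𝓞 E) u.asIdeal :=
    fun u hu => isUnramifiedIn_algOfLE_of_ramificationSubgroup_le_galFixing S hF hS u
      (fun h => hu ((hSF u).2 h))
  have hSu₁ : ∀ u : HeightOneSpectrum (𝓞 F₀), u ∉ S₀ →
      Algebra.IsUnramifiedIn (R := 𝓞 F₀) (𝓞 E₁) u.asIdeal :=
    fun u hu => isUnramifiedIn_algOfLE_of_ramificationSubgroup_le_galFixing S (hF.trans h₁) hS₁ u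
      (fun h => hu ((hSF u).2 h))
  -- the bridge image of `c` is `p`-torsion, hence dies two layers up in the idelic model
  set x : groupCohomology (sUnitsIdeleRep F₀ E S₀) 3 :=
    groupCohomology.map (A := sUnitsRep K S F₀ E) (B := sUnitsIdeleRep F₀ E S₀)
      (MonoidHom.id (E ≃ₐ[F₀] E)) (sUnitsBridge (E := E) S S₀ hSF) 3 c with hxdef
  have hx : (p : ℤ) • x = 0 := by
    rw [hxdef, ← map_zsmul, natCast_zsmul, hc, map_zero]
  have key := sUnitsIdeleInf_sUnitsIdeleInf_three_eq_zero (F := F₀) (E := E) (E₁ := E₁) (E₂ := E₂) S₀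
    hSu hSu₁ hpp hSne hdeg hcap x hx
  -- transport back to the integral model
  have ht := map_sUnitsBridge_layerInf_eq S hF h₁ h₂ S₀ hSF 3 c
  rw [← hxdef, key] at ht
  exact map_sUnitsBridge_injective (E := E₂) S S₀ hSF 3 (by rw [ht, map_zero])

end Literature.NumberTheory.GaloisCohomology

end
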